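import Mathlib
import Literature.Analysis.OperatorTheory.ContractiveDeterminantalRepresentations
import HarnessLib

/-!
# Crux `PriceOfContractivity` (stmt-ValiantsHypothesis-10583), line `registered` (birth rev 8) —
# stub `stub_minorBound_directSum` (♦ is closed under direct sums)

Route `ValiantsHypothesis/ContractivityPrice`, crux K1
(`Summit.ValiantsHypothesis.ValiantsHypothesis.Theses.ContractivityPrice.PriceOfContractivity`).
The open composing stub `stub_stableLifting` (♦) of the lead's skeleton asks to re-realize a
zero-free Sylvester pencil by a matrix `K₁` ALL of whose principal minors `det K₁[w]`
(`w : Fin (k+1) → Fin R₁` injective) have modulus `≤ B ^ (k+1)`.  This file proves the registered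
structural stub `stub_minorBound_directSum`: that minor bound is preserved by direct sums.  If every
principal `(k+1) × (k+1)` minor of `K₁ : Matrix (Fin S₁) (Fin S₁) ℂ` and of
`K₂ : Matrix (Fin S₂) (Fin S₂) ℂ` has modulus `≤ B ^ (k+1)`, then so does every principal minor of
the direct sum
`K₁ ⊕ K₂ := Matrix.reindex finSumFinEquiv finSumFinEquiv (Matrix.fromBlocks K₁ 0 0 K₂)`.

Proof (folklore linear algebra).  Fix an injective `w : Fin (k+1) → Fin (S₁ + S₂)` and put
`u := finSumFinEquiv.symm ∘ w : Fin (k+1) → Fin S₁ ⊕ Fin S₂`, so that the minor is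
`M := (fromBlocks K₁ 0 0 K₂).submatrix u u`.  With the predicate `p i := (u i).isLeft`, the entries
`M i j` with `¬ p i`, `p j` lie in the vanishing off-diagonal block, so `M` is two-block-triangular
and `det M = det M[p] * det M[¬p]` (`Matrix.twoBlockTriangular_det`).  The `p`-block is the
principal submatrix of `K₁` on the (injective) left components of `u`, the `¬p`-block the principal
submatrix of `K₂` on the right components; reindexing each block by `Fin (card)` (determinant
unchanged, `Matrix.det_submatrix_equiv_self`; an empty block has determinant `1 = B ^ 0`) the
hypotheses bound their determinants by `B ^ card {i // p i}` and `B ^ card {i // ¬ p i}`, whose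
product is `B ^ (k+1)` since the two cardinalities add up to `k + 1`.
-/

noncomputable section

-- `Summit.<Summit>.<Problem>` repeats `ValiantsHypothesis` by the tree's layout convention (D-0017).
set_option linter.dupNamespace false

namespace Summit.ValiantsHypothesis.ValiantsHypothesis.Theorems.PriceOfContractivity.DirectSum

open Matrix

/-- From the `Fin (k+1)`-indexed minor bound to an arbitrarily indexed one: if every principal
minor `det K[w]` of `K : Matrix (Fin S) (Fin S) ℂ` indexed by an injective `w : Fin (k+1) → Fin S`
has modulus `≤ B ^ (k+1)`, then for every finite type `ι` and injective `a : ι → Fin S` the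
principal minor `det (K.submatrix a a)` has modulus `≤ B ^ card ι` (for empty `ι` the determinant
is `1 = B ^ 0`; otherwise reindex by `ι ≃ Fin (card ι)`, which does not change the determinant). -/
private theorem norm_det_submatrix_le_pow_card {S : ℕ} {B : ℝ} (K : Matrix (Fin S) (Fin S) ℂ)
    (hK : ∀ (k : ℕ) (w : Fin (k + 1) → Fin S), Function.Injective w →
      ‖(K.submatrix w w).det‖ ≤ B ^ (k + 1))
    {ι : Type*} [Fintype ι] [DecidableEq ι] (a : ι → Fin S) (ha : Function.Injective a) :
    ‖(K.submatrix a a).det‖ ≤ B ^ Fintype.card ι := by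
  rcases hn : Fintype.card ι with _ | n
  · haveI : IsEmpty ι := Fintype.card_eq_zero_iff.mp hn
    rw [Matrix.det_isEmpty, norm_one, pow_zero]
  · -- reindex the minor by `e : ι ≃ Fin (n+1)`; the determinant is unchanged
    set e : ι ≃ Fin (n + 1) := Fintype.equivFinOfCardEq hn
    have hdet : (K.submatrix (a ∘ e.symm) (a ∘ e.symm)).det = (K.submatrix a a).det := by
      rw [← Matrix.submatrix_submatrix, Matrix.det_submatrix_equiv_self]
    rw [← hdet]
    exact hK n (a ∘ e.symm) (ha.comp e.symm.injective)

/-- The direct-sum minor bound, for an arbitrarily indexed principal submatrix of the block-diagonal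
matrix `fromBlocks K₁ 0 0 K₂` (indices in `Fin S₁ ⊕ Fin S₂`): if the principal minors of `K₁` and of
`K₂` obey the `B ^ size` bound, then for every finite type `ι` and injective
`u : ι → Fin S₁ ⊕ Fin S₂`, `‖det ((fromBlocks K₁ 0 0 K₂).submatrix u u)‖ ≤ B ^ card ι`.  The
submatrix is two-block-triangular with respect to `p i := (u i).isLeft` (its off-diagonal blocks are
blocks of the zero corners), its diagonal blocks are principal submatrices of `K₁` and `K₂` on the
left, resp. right, components of `u`, and the block sizes add up to `card ι`. -/
private theorem norm_det_submatrix_fromBlocks_le_pow_card {S₁ S₂ : ℕ} {B : ℝ}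
    (K₁ : Matrix (Fin S₁) (Fin S₁) ℂ) (K₂ : Matrix (Fin S₂) (Fin S₂) ℂ)
    (h₁ : ∀ (k : ℕ) (w : Fin (k + 1) → Fin S₁), Function.Injective w →
      ‖(K₁.submatrix w w).det‖ ≤ B ^ (k + 1))
    (h₂ : ∀ (k : ℕ) (w : Fin (k + 1) → Fin S₂), Function.Injective w →
      ‖(K₂.submatrix w w).det‖ ≤ B ^ (k + 1))
    {ι : Type*} [Fintype ι] [DecidableEq ι] (u : ι → Fin S₁ ⊕ Fin S₂)
    (hu : Function.Injective u) :
    ‖((Matrix.fromBlocks K₁ 0 0 K₂).submatrix u u).det‖ ≤ B ^ Fintype.card ι := by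
  set M : Matrix ι ι ℂ := (Matrix.fromBlocks K₁ 0 0 K₂).submatrix u u with hM
  -- the predicate "the index lands in the left block"
  let p : ι → Prop := fun i => (u i).isLeft
  -- left components of `u` on `{i // p i}`, right components on `{i // ¬ p i}`
  let a : {i // p i} → Fin S₁ := fun i => (u i).getLeft i.2
  have ha : ∀ i : {i // p i}, u i = Sum.inl (a i) := fun i => (Sum.inl_getLeft (u i) i.2).symm
  let b : {i // ¬p i} → Fin S₂ := fun i => (u i).getRight (Sum.not_isLeft.mp i.2)
  have hb : ∀ i : {i // ¬p i}, u i = Sum.inr (b i) := fun i =>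
    (Sum.inr_getRight (u i) (Sum.not_isLeft.mp i.2)).symm
  have ha_inj : Function.Injective a := by
    intro i j hij
    apply Subtype.ext
    apply hu
    rw [ha i, ha j, hij]
  have hb_inj : Function.Injective b := by
    intro i j hij
    apply Subtype.ext
    apply hu
    rw [hb i, hb j, hij]
  -- `M` is two-block-triangular with respect to `p`
  have htri : ∀ i, ¬p i → ∀ j, p j → M i j = 0 := by
    intro i hi j hj
    have hi' : u i = Sum.inr (b ⟨i, hi⟩) := hb ⟨i, hi⟩
    have hj' : u j = Sum.inl (a ⟨j, hj⟩) := ha ⟨j, hj⟩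
    simp only [hM, Matrix.submatrix_apply, hi', hj', Matrix.fromBlocks_apply₂₁, Matrix.zero_apply]
  -- its diagonal blocks are principal submatrices of `K₁` and `K₂`
  have hblock₁ : M.toSquareBlockProp p = K₁.submatrix a a := by
    ext i j
    simp only [Matrix.toSquareBlockProp_def, Matrix.of_apply, hM, Matrix.submatrix_apply, ha i,
      ha j, Matrix.fromBlocks_apply₁₁]
  have hblock₂ : (M.toSquareBlockProp fun i => ¬p i) = K₂.submatrix b b := by
    ext i j
    simp only [Matrix.toSquareBlockProp_def, Matrix.of_apply, hM, Matrix.submatrix_apply, hb i,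
      hb j, Matrix.fromBlocks_apply₂₂]
  have hdet : M.det = (K₁.submatrix a a).det * (K₂.submatrix b b).det := by
    rw [Matrix.twoBlockTriangular_det M p htri, hblock₁, hblock₂]
  -- the bounds on the two blocks
  have hB₁ : ‖(K₁.submatrix a a).det‖ ≤ B ^ Fintype.card {i // p i} :=
    norm_det_submatrix_le_pow_card K₁ h₁ a ha_inj
  have hB₂ : ‖(K₂.submatrix b b).det‖ ≤ B ^ Fintype.card {i // ¬p i} :=
    norm_det_submatrix_le_pow_card K₂ h₂ b hb_inj
  -- the block sizes add up to `card ι`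
  have hcard : Fintype.card {i // p i} + Fintype.card {i // ¬p i} = Fintype.card ι := by
    rw [Fintype.card_subtype_compl, Nat.add_sub_cancel' (Fintype.card_subtype_le p)]
  calc ‖M.det‖ = ‖(K₁.submatrix a a).det‖ * ‖(K₂.submatrix b b).det‖ := by
        rw [hdet, norm_mul]
    _ ≤ B ^ Fintype.card {i // p i} * B ^ Fintype.card {i // ¬p i} :=
        mul_le_mul hB₁ hB₂ (norm_nonneg _) ((norm_nonneg _).trans hB₁)
    _ = B ^ Fintype.card ι := by rw [← pow_add, hcard]

/-- **Stub `stub_minorBound_directSum`** (♦ is closed under direct sums).  If every principal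
`(k+1) × (k+1)` minor of `K₁ : Matrix (Fin S₁) (Fin S₁) ℂ` and of `K₂ : Matrix (Fin S₂) (Fin S₂) ℂ`
(indexed by an injective `w : Fin (k+1) → Fin Sᵢ`) has modulus `≤ B ^ (k+1)`, then every principal
`(k+1) × (k+1)` minor of the direct sum
`Matrix.reindex finSumFinEquiv finSumFinEquiv (Matrix.fromBlocks K₁ 0 0 K₂)` has modulus
`≤ B ^ (k+1)`: the indexed submatrix is two-block-triangular with respect to "the index lands in the
left block", its diagonal blocks are principal submatrices of `K₁` and `K₂`, and the exponents add. -/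
theorem stub_minorBound_directSum :
    ∀ (S₁ S₂ : ℕ) (B : ℝ) (K₁ : Matrix (Fin S₁) (Fin S₁) ℂ) (K₂ : Matrix (Fin S₂) (Fin S₂) ℂ),
      (∀ (k : ℕ) (w : Fin (k + 1) → Fin S₁), Function.Injective w →
        ‖(K₁.submatrix w w).det‖ ≤ B ^ (k + 1)) →
      (∀ (k : ℕ) (w : Fin (k + 1) → Fin S₂), Function.Injective w →
        ‖(K₂.submatrix w w).det‖ ≤ B ^ (k + 1)) →
      ∀ (k : ℕ) (w : Fin (k + 1) → Fin (S₁ + S₂)), Function.Injective w →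
        ‖((Matrix.reindex finSumFinEquiv finSumFinEquiv (Matrix.fromBlocks K₁ 0 0 K₂)).submatrix w w).det‖ ≤
          B ^ (k + 1) := by
  intro S₁ S₂ B K₁ K₂ h₁ h₂ k w hw
  have h := norm_det_submatrix_fromBlocks_le_pow_card K₁ K₂ h₁ h₂ (finSumFinEquiv.symm ∘ w)
    (finSumFinEquiv.symm.injective.comp hw)
  rw [Fintype.card_fin] at h
  simpa only [Matrix.reindex_apply, Matrix.submatrix_submatrix] using h

end Summit.ValiantsHypothesis.ValiantsHypothesis.Theorems.PriceOfContractivity.DirectSum
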